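import Summits.Ventures.QEC.Census.CSSLPCertificate
import HarnessLib

/-!
# Integer branch-and-bound certificates for the CSS linear program: «no CSS `[[n, k, D]]`» when the relaxation is feasible
# but has no INTEGRAL point

LADDER-QEC (venture cell `qec`), CENSUS-PREREG C.2 extension `13 ≤ n ≤ 16`, item 02.CSS133 (qec-type-02 g5, self-named).
Continuation of `Census/CSSLPCertificate.lean`. The weight distributions `α_j = #{v ∈ rs H^X : |v| = j}`,
`β_j = #{v ∈ rs H^Z : |v| = j}` of a CSS code are not only a feasible point of the CSS linear program `cssLPRows n a b D _`,
they are INTEGERS. qec-search-5 g3 (census/search-5/css-n16/OPEN-CELLS-g3.md, `code/g3/css_ip.py`, kit j273500) used this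
to close the cell `(13,3)` of the CSS distance table OUTSIDE the kernel: for `D = 4` the relaxation is infeasible at every
split `a + b = 10` except `(5,5)`, where an exact branch-and-bound tree (branching `α_j ≤ t ∨ α_j ≥ t + 1`, 159 leaves, every
leaf an exact-rational Farkas certificate) has no integral point. This file is the KERNEL checker for such trees:

* bound rows `rowLe isBeta j t` («`x_j ≤ t`», written `−x_j ≥ −t`) and `rowGe isBeta j t` («`x_j ≥ t`»), `x = α` or `β`;
* `BBTree` (leaf = Farkas multipliers; branch = variable, threshold, two subtrees) and the checker
  `bbCheck base n T bounds : Bool` — at a leaf, `farkasCheck (base ++ bounds) ys n`; at a branch on `(x_j, t)` (with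
  `j ≤ n`), the left subtree is checked with the extra row `x_j ≤ t` and the right one with `x_j ≥ t + 1`;
* `IsIntegralPt x` (`∀ r, x_r ∈ ℕ`), `NoIntPoint rows n` (no nonnegative INTEGRAL point satisfies the rows), and SOUNDNESS
  `noIntPoint_of_bbCheck : bbCheck base n T bounds = true → NoIntPoint (base ++ bounds) n` (induction on the tree: an
  integral coordinate is `≤ t` or `≥ t + 1`, `noIntPoint_of_split`), `noIntPoint_of_farkasCheck` (a plain certificate);
* the census form **`css_min_dX_dZ_lt_of_noIntPoint`**: `NoIntPoint (cssLPRows n a b D false) n` gives `min (d^X, d^Z) < D`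
  for every CSS code on `n` qubits with `rank H^X = a`, `rank H^Z = b` (the weight distributions `alphaOf`, `betaOf` are
  casts of naturals, `lpFeasible_cssLPRows_of_le`).
Statements about subtrees compose through `noIntPoint_of_split`, so a large tree is checked in pieces (`≤ 400`-line files,
one `decide +kernel` per piece) and assembled without re-quoting the certificates. The cell files
`Census/CSS/UpperIPN13K3*.lean` discharge `(13,3)` with qec-search-5's tree, TRANSLATED leaf by leaf into this row language
(their model carries the dual distributions `A⊥_j`, `B⊥_j` as extra integer unknowns; eliminating them by MacWilliams maps a
certificate `(μ, λ)` to multipliers `−μ` on our rows, bound multipliers unchanged — every translated leaf re-verified here by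
the kernel, so nothing of the producer is trusted). HONEST FRAMING: still a relaxation of «a CSS `[[n,k,D]]` exists» —
integrality of four weight distributions, MacWilliams, containment and the distance equalities; infeasibility refutes
existence, feasibility (cells (14,3), (15,3), (15,4), (16,1): integral points exist) proves nothing. [folklore] throughout
(LP duality [cite: MacWilliamsSloane1977, Ch. 17 §4 Thm. 20]; branch and bound = case split on an integer unknown).
-/

namespace Summit.Ventures.QEC.Census

open Finset Literature.InformationTheory.Coding Literature.InformationTheory.QuantumCodes

/-! ## Bound rows, trees, the checker -/

/-- Row «`x_j ≤ t`» for `x = α` (`isBeta = false`) or `x = β` (`isBeta = true`), as the `≥`-row `−x_j ≥ −t`. [folklore] -/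
def rowLe (isBeta : Bool) (j t : ℕ) : LPRow :=
  if isBeta then ⟨fun _ => 0, fun r => if r = j then -1 else 0, -(t : ℚ), false⟩
  else ⟨fun r => if r = j then -1 else 0, fun _ => 0, -(t : ℚ), false⟩

/-- Row «`x_j ≥ t`» for `x = α` or `β`. [folklore] -/
def rowGe (isBeta : Bool) (j t : ℕ) : LPRow :=
  if isBeta then ⟨fun _ => 0, fun r => if r = j then 1 else 0, (t : ℚ), false⟩
  else ⟨fun r => if r = j then 1 else 0, fun _ => 0, (t : ℚ), false⟩

/-- A branch-and-bound certificate tree: a leaf carries Farkas multipliers for the rows accumulated along its path; a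
branch names an unknown `x_j` (`x = α`/`β`) and a threshold `t` and has the subtrees for `x_j ≤ t` and `x_j ≥ t + 1`.
(definition, ours) [folklore] -/
inductive BBTree where
  /-- a leaf: multipliers for `base ++ bounds` -/
  | leaf (ys : List ℚ)
  /-- a branch on `x_j ≤ t` / `x_j ≥ t + 1` -/
  | branch (isBeta : Bool) (j t : ℕ) (le ge : BBTree)

/-- **The branch-and-bound checker** (pure `Bool`, exact rationals; close instances by `decide +kernel`): every leaf is a
checked Farkas certificate for `base ++` the bound rows of its path, every branch variable has index `≤ n`. [folklore] -/
def bbCheck (base : List LPRow) (n : ℕ) : BBTree → List LPRow → Bool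
  | .leaf ys, bounds => farkasCheck (base ++ bounds) ys n
  | .branch isBeta j t l g, bounds =>
      decide (j ≤ n) && (bbCheck base n l (bounds ++ [rowLe isBeta j t]) && bbCheck base n g (bounds ++ [rowGe isBeta j (t + 1)]))

/-! ## Integral points and soundness -/

/-- All coordinates are natural numbers. (A predicate with parameters, ours — not a named fact.)
[cite: MacWilliamsSloane1977, Ch. 5 §2 eq. (1) (weight distributions are counts)] -/
structure IsIntegralPt (x : ℕ → ℚ) : Prop where
  /-- every coordinate is the cast of a natural number -/
  natCast : ∀ r, ∃ m : ℕ, x r = m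

/-- **No integral feasible point**: no pair of nonnegative INTEGRAL vectors satisfies the rows. (A predicate with
parameters, ours — not a named fact.) [cite: MacWilliamsSloane1977, Ch. 17 §4 Thm. 20 (feasibility; here restricted to integral points)] -/
structure NoIntPoint (rows : List LPRow) (n : ℕ) : Prop where
  /-- no integral feasible point -/
  out : ∀ α β : ℕ → ℚ, IsIntegralPt α → IsIntegralPt β → ¬ LPFeasible rows n α β

/-- A plain Farkas certificate excludes every point, in particular every integral one. [folklore] -/
theorem noIntPoint_of_farkasCheck {rows : List LPRow} {ys : List ℚ} {n : ℕ} (h : farkasCheck rows ys n = true) :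
    NoIntPoint rows n :=
  ⟨fun _ _ _ _ => not_lpFeasible_of_farkasCheck h⟩

/-- Adding a satisfied row keeps a point feasible. [folklore] -/
theorem lpFeasible_append_singleton {rows : List LPRow} {n : ℕ} {α β : ℕ → ℚ} (h : LPFeasible rows n α β) {row : LPRow}
    (hrow : row.Sat n α β) : LPFeasible (rows ++ [row]) n α β := by
  refine ⟨h.nonnegA, h.nonnegB, fun r hr => ?_⟩
  rw [List.mem_append, List.mem_singleton] at hr
  rcases hr with hr | rfl
  · exact h.sat r hr
  · exact hrow

/-- Evaluating an indicator row picks one unknown (helper). [folklore] -/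
private theorem sum_ite_eq_mul' (n j : ℕ) (hj : j ≤ n) (c : ℚ) (x : ℕ → ℚ) :
    ∑ r ∈ range (n + 1), (if r = j then c else 0) * x r = c * x j := by
  rw [Finset.sum_eq_single_of_mem j (by rw [mem_range]; omega) (fun r _ hr => by rw [if_neg hr, zero_mul]), if_pos rfl]

/-- The row «`x_j ≤ t`» holds at a point with `x_j ≤ t` (`j ≤ n`). [folklore] -/
theorem sat_rowLe {n j t : ℕ} (hj : j ≤ n) (isBeta : Bool) {α β : ℕ → ℚ}
    (h : (if isBeta then β j else α j) ≤ t) : (rowLe isBeta j t).Sat n α β := by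
  cases isBeta
  · refine ⟨fun h' => absurd h' (by simp [rowLe]), fun _ => ?_⟩
    simp only [rowLe, Bool.false_eq_true, ↓reduceIte, LPRow.eval, zero_mul, Finset.sum_const_zero, add_zero]
    rw [sum_ite_eq_mul' n j hj]
    simp only [Bool.false_eq_true, ↓reduceIte] at h
    linarith
  · refine ⟨fun h' => absurd h' (by simp [rowLe]), fun _ => ?_⟩
    simp only [rowLe, ↓reduceIte, LPRow.eval, zero_mul, Finset.sum_const_zero, zero_add]
    rw [sum_ite_eq_mul' n j hj]
    simp only [↓reduceIte] at h
    linarith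

/-- The row «`x_j ≥ t`» holds at a point with `t ≤ x_j` (`j ≤ n`). [folklore] -/
theorem sat_rowGe {n j t : ℕ} (hj : j ≤ n) (isBeta : Bool) {α β : ℕ → ℚ}
    (h : (t : ℚ) ≤ (if isBeta then β j else α j)) : (rowGe isBeta j t).Sat n α β := by
  cases isBeta
  · refine ⟨fun h' => absurd h' (by simp [rowGe]), fun _ => ?_⟩
    simp only [rowGe, Bool.false_eq_true, ↓reduceIte, LPRow.eval, zero_mul, Finset.sum_const_zero, add_zero]
    rw [sum_ite_eq_mul' n j hj]
    simp only [Bool.false_eq_true, ↓reduceIte] at h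
    linarith
  · refine ⟨fun h' => absurd h' (by simp [rowGe]), fun _ => ?_⟩
    simp only [rowGe, ↓reduceIte, LPRow.eval, zero_mul, Finset.sum_const_zero, zero_add]
    rw [sum_ite_eq_mul' n j hj]
    simp only [↓reduceIte] at h
    linarith

/-- **Branching is sound**: an integral point has `x_j ≤ t` or `x_j ≥ t + 1`, so if neither refinement has an integral
feasible point, the system has none. Shape: `base ++ bounds` refines to `base ++ (bounds ++ [row])`. [folklore] -/
theorem noIntPoint_of_split (base bounds : List LPRow) (n : ℕ) (isBeta : Bool) {j : ℕ} (hj : j ≤ n) (t : ℕ)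
    (hle : NoIntPoint (base ++ (bounds ++ [rowLe isBeta j t])) n)
    (hge : NoIntPoint (base ++ (bounds ++ [rowGe isBeta j (t + 1)])) n) : NoIntPoint (base ++ bounds) n := by
  refine ⟨fun α β hα hβ hfeas => ?_⟩
  obtain ⟨mA, hmA⟩ := hα.natCast j
  obtain ⟨mB, hmB⟩ := hβ.natCast j
  -- the branched coordinate as a natural number
  obtain ⟨m, hm⟩ : ∃ m : ℕ, (if isBeta then β j else α j) = m := by
    cases isBeta
    · exact ⟨mA, by simpa using hmA⟩
    · exact ⟨mB, by simpa using hmB⟩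
  rcases Nat.lt_or_ge t m with hlt | hge'
  · refine hge.out α β hα hβ ?_
    rw [← List.append_assoc]
    exact lpFeasible_append_singleton hfeas (sat_rowGe hj isBeta (by rw [hm]; exact_mod_cast hlt))
  · refine hle.out α β hα hβ ?_
    rw [← List.append_assoc]
    exact lpFeasible_append_singleton hfeas (sat_rowLe hj isBeta (by rw [hm]; exact_mod_cast hge'))

/-- **Soundness of the branch-and-bound checker**: a checked tree over `base` with accumulated `bounds` excludes every
integral feasible point of `base ++ bounds`. [folklore] -/
theorem noIntPoint_of_bbCheck (base : List LPRow) (n : ℕ) :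
    ∀ (T : BBTree) (bounds : List LPRow), bbCheck base n T bounds = true → NoIntPoint (base ++ bounds) n
  | .leaf ys, bounds, h => noIntPoint_of_farkasCheck (by simpa [bbCheck] using h)
  | .branch isBeta j t l g, bounds, h => by
      simp only [bbCheck, Bool.and_eq_true, decide_eq_true_eq] at h
      obtain ⟨hj, hl, hg⟩ := h
      exact noIntPoint_of_split base bounds n isBeta hj t (noIntPoint_of_bbCheck base n l _ hl)
        (noIntPoint_of_bbCheck base n g _ hg)

/-- The root form: a checked tree with no initial bounds excludes every integral feasible point of `base`. [folklore] -/
theorem noIntPoint_of_bbCheck_nil {base : List LPRow} {n : ℕ} (T : BBTree) (h : bbCheck base n T [] = true) :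
    NoIntPoint base n := by
  have h' := noIntPoint_of_bbCheck base n T [] h
  rwa [List.append_nil] at h'

/-! ## The census form -/

section Soundness

variable {n : ℕ} {RX RZ : Type*} [Fintype RX] [Fintype RZ]

omit [Fintype RZ] in
/-- The weight distribution of `rs H^X` is integral. [folklore] -/
theorem isIntegralPt_alphaOf (C : CSSCode RX RZ (Fin n)) : IsIntegralPt (alphaOf C) := ⟨fun _ => ⟨_, rfl⟩⟩

omit [Fintype RX] in
/-- The weight distribution of `rs H^Z` is integral. [folklore] -/
theorem isIntegralPt_betaOf (C : CSSCode RX RZ (Fin n)) : IsIntegralPt (betaOf C) := ⟨fun _ => ⟨_, rfl⟩⟩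

/-- **No CSS code of an IP-certified cell beats `D − 1`**: if the CSS linear program `cssLPRows n a b D false` has no
INTEGRAL feasible point, every CSS code on `n` qubits with `rank H^X = a`, `rank H^Z = b` has `min (d^X, d^Z) < D`
(its weight distributions would be such a point). [folklore] -/
theorem css_min_dX_dZ_lt_of_noIntPoint {a b D : ℕ} (h : NoIntPoint (cssLPRows n a b D false) n)
    (C : CSSCode RX RZ (Fin n)) (ha : C.HX.rank = a) (hb : C.HZ.rank = b) : min C.dX C.dZ < D := by
  by_contra hge
  rw [not_lt, le_min_iff] at hge
  exact h.out (alphaOf C) (betaOf C) (isIntegralPt_alphaOf C) (isIntegralPt_betaOf C)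
    (lpFeasible_cssLPRows_of_le C ha hb hge.1 hge.2)

end Soundness

end Summit.Ventures.QEC.Census
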